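import Summits.CriticalPhenomena.PercolationContinuityZ3.Theses.PercShatteringRace
import Summits.CriticalPhenomena.PercolationContinuityZ3.Theorems.PercShatteringRaceFreeSusceptibilityPowerSavingPersistPoly
import Literature.Probability.Percolation.NonBacktrackingPathCounting
import Literature.Probability.Percolation.CriticalContinuityProofs
import Mathlib.Analysis.Calculus.Deriv.MeanValue
import Mathlib.Analysis.SpecialFunctions.Sqrt
import Mathlib.Analysis.SpecialFunctions.Pow.Real

/-!
# PERSIST (part 2): the free susceptibility at `p_c` versus a scale-dependent subcritical point

Support lemma for the crux `PercShatteringRace.FreeSusceptibilityPowerSaving` = S(1/2)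
(item stmt-CriticalPhenomena-5786), requested by the crux-strategist's census
(`Cruxes/FreeSusceptibilityPowerSaving/STRATEGY-CENSUS.md` §4 S⁺2 / §8 rec. 4).  Part 2 of 2; part 1
(`…PersistPoly.lean`) supplies `(q(1-q))² χ'(q)² ≤ |Λ||T| q(1-q) χ(q)` on the cylinder polynomial.

Here: the polynomial IS the free susceptibility `χᶠ_R(p) = Σ_{y ∈ Λ} P_p(0 ↔ y inside Λ)` on `[0,1]`
(`Persist.chi_eq_freeSusc`), `χ ≥ 1`, `|T| ≤ 2d|Λ|`; hence `√χᶠ_R` is Lipschitz on `[a,b] ⊂ (0,1)`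
with constant `½ √(2d (2R+1)^{2d}/(a(1-b))) = O(R^d)` (`Persist.sqrt_freeSusc_sub_le`, mean value
theorem).  For `d = 3` (`p_c ≥ 1/5` by path counting, `p_c < 1`):

* `Persist.sqrt_freeSusc_crit_le`: `√χᶠ_R(p_c) ≤ √χᶠ_R(p) + ½√(36(2R+1)⁶/(1-p_c)) (p_c - p)` for
  `1/6 ≤ p ≤ p_c`;
* `freeSusceptibilityPowerSaving_iff_persist`: the crux S(1/2) at `p_c` is EQUIVALENT to the same
  `R^{5/2}` bound at the SUBCRITICAL parameter `p_R = p_c - R^{-7/4}/68` (census `PersistForm`).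

The census (D4) records why this closes rather than opens the "work below `p_c`" door: the window
`R^{-7/4}` is inside the critical window `R^{-1/ν}`.  No definitions are introduced.
-/

namespace Summit.CriticalPhenomena.PercolationContinuityZ3.Theorems

open MeasureTheory
open Literature.Probability.Percolation Literature.Probability.LatticeModels
open Literature.Probability.Percolation.Russo Literature.Probability.Percolation.DCT16
open scoped Classical

noncomputable section

namespace Persist
variable {d : ℕ} {R : ℕ}

set_option quotPrecheck false

/-- The genuine edges among the pairs of the box: `T = Λ.sym2 ∩ E(ℤ^d)`. -/
local notation "𝒯" => (((box d R).sym2).filter fun e => e ∈ (zdGraph d).edgeSet)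

/-- The in-box connection events `A_y = {0 ↔ y inside Λ}`. -/
local notation "𝒜⟦" y "⟧" => (openConnIn (↑(box d R) : Set (Site d)) (0 : Site d) y)

/-- The free susceptibility polynomial `χ(q) = Σ_{y ∈ Λ} cylPoly E Λ.sym2 A_y q`. -/
local notation "χ⟦" q "⟧" =>
  (∑ y ∈ box d R, cylPoly (zdGraph d).edgeSet (box d R).sym2 𝒜⟦y⟧ (q : ℝ))

/-- Its derivative, as delivered by `Russo.hasDerivAt_cylPoly` term by term. -/
local notation "χ'⟦" q "⟧" =>
  (∑ y ∈ box d R, ∑ e ∈ (box d R).sym2, ∑ S ∈ ((box d R).sym2).powerset,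
    (if ((↑(S : Finset (Sym2 (Site d)))) : Set (Sym2 (Site d))) ∈ 𝒜⟦y⟧ then
      (∏ j ∈ ((box d R).sym2).erase e, weight (zdGraph d).edgeSet
        ((↑(S : Finset (Sym2 (Site d)))) : Set (Sym2 (Site d))) j (q : ℝ)) *
        dweight (zdGraph d).edgeSet ((↑(S : Finset (Sym2 (Site d)))) : Set (Sym2 (Site d))) e
     else 0))

/-! ### §4 The polynomial is the free susceptibility; counting pairs -/

/-- On `[0,1]` the cylinder polynomial computes the probability:
`χ(p) = Σ_{y ∈ Λ} P_p(0 ↔ y inside Λ) = χᶠ_R(p)`. -/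
theorem chi_eq_freeSusc (p : unitInterval) :
    χ⟦(p : ℝ)⟧ = ∑ y ∈ box d R, (bondPercolation (zdGraph d) p).real 𝒜⟦y⟧ := by
  refine Finset.sum_congr rfl fun y _ => ?_
  rw [bondPercolation]
  exact (measureReal_eq_cylPoly (determinedBy_openConnIn (↑(box d R) : Set (Site d)) 0 y
    (K := (↑(box d R).sym2 : Set (Sym2 (Site d)))) (by rw [Finset.coe_sym2])) _ p).symm

/-- The `y = 0` event is sure: `{0 ↔ 0 inside Λ} = univ`. -/
theorem openConnIn_zero_eq_univ : 𝒜⟦(0 : Site d)⟧ = Set.univ := by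
  have h0 : (0 : Site d) ∈ (↑(box d R) : Set (Site d)) := Finset.mem_coe.2 (zero_mem_box d R)
  exact Set.eq_univ_of_forall fun ω => ⟨h0, h0, SimpleGraph.Reachable.refl _⟩

/-- `χᶠ_R(p) ≥ 1` (the `y = 0` term). -/
theorem one_le_freeSusc (p : unitInterval) :
    1 ≤ ∑ y ∈ box d R, (bondPercolation (zdGraph d) p).real 𝒜⟦y⟧ := by
  have h1 : (bondPercolation (zdGraph d) p).real 𝒜⟦(0 : Site d)⟧ = 1 := by
    rw [openConnIn_zero_eq_univ, probReal_univ]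
  rw [← h1]
  exact Finset.single_le_sum (f := fun y => (bondPercolation (zdGraph d) p).real 𝒜⟦y⟧)
    (fun _ _ => measureReal_nonneg) (zero_mem_box d R)

/-- `χ(q) ≥ 1` for `q ∈ [0,1]`. -/
theorem one_le_chi {q : ℝ} (hq0 : 0 ≤ q) (hq1 : q ≤ 1) : 1 ≤ χ⟦q⟧ := by
  have h := one_le_freeSusc (d := d) (R := R) ⟨q, hq0, hq1⟩
  rwa [← chi_eq_freeSusc] at h

/-- The genuine edges of the box are at most `2d |Λ|` in number. -/
theorem card_T_le : ((𝒯).card : ℝ) ≤ 2 * d * (box d R).card := by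
  have hsub : 𝒯 ⊆ (box d R).biUnion fun x =>
      ((zdGraph d).neighborFinset x).image fun y => s(x, y) := by
    intro e he
    obtain ⟨heK, heE⟩ := mem_T_iff.1 he
    induction e using Sym2.ind with
    | h x y =>
      rw [Finset.mk_mem_sym2_iff] at heK
      rw [SimpleGraph.mem_edgeSet] at heE
      exact Finset.mem_biUnion.2 ⟨x, heK.1, Finset.mem_image.2
        ⟨y, (SimpleGraph.mem_neighborFinset _ _ _).2 heE, rfl⟩⟩
  have h1 : (𝒯).card ≤ ∑ x ∈ box d R, (((zdGraph d).neighborFinset x).image fun y => s(x, y)).card :=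
    (Finset.card_le_card hsub).trans Finset.card_biUnion_le
  have h2 : ∀ x ∈ box d R, (((zdGraph d).neighborFinset x).image fun y => s(x, y)).card ≤ 2 * d :=
    fun x _ => Finset.card_image_le.trans (card_neighborFinset_zdGraph_holds x).le
  have h3 : (𝒯).card ≤ 2 * d * (box d R).card := by
    calc (𝒯).card ≤ ∑ x ∈ box d R, (((zdGraph d).neighborFinset x).image fun y => s(x, y)).card := h1
      _ ≤ ∑ _x ∈ box d R, 2 * d := Finset.sum_le_sum h2
      _ = 2 * d * (box d R).card := by rw [Finset.sum_const, smul_eq_mul, mul_comm]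
  exact_mod_cast h3

/-! ### §5 Integration: `√χ` is Lipschitz on compact sub-intervals of `(0,1)` -/

/-- The derivative of `√χ` is at most `½ √(|Λ||T|/(q(1-q)))` on `(0,1)`. -/
theorem deriv_sqrt_chi_le {q : ℝ} (hq0 : 0 < q) (hq1 : q < 1) :
    χ'⟦q⟧ / (2 * Real.sqrt χ⟦q⟧) ≤
      (1 / 2) * Real.sqrt ((box d R).card * (𝒯).card / (q * (1 - q))) := by
  have hχ : 1 ≤ χ⟦q⟧ := one_le_chi hq0.le hq1.le
  have hχpos : 0 < χ⟦q⟧ := by linarith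
  have hsq : 0 < Real.sqrt χ⟦q⟧ := Real.sqrt_pos.2 hχpos
  have hqq : 0 < q * (1 - q) := mul_pos hq0 (by linarith)
  have hb := deriv_sq_bound (d := d) (R := R) hq0.le hq1.le
  -- `χ'² ≤ (|Λ||T|/(q(1-q))) · χ`
  have h1 : (χ'⟦q⟧) ^ 2 ≤ (box d R).card * (𝒯).card / (q * (1 - q)) * χ⟦q⟧ := by
    rw [div_mul_eq_mul_div, le_div_iff₀ hqq]
    have : (q * (1 - q)) ^ 2 * (χ'⟦q⟧) ^ 2 ≤ (box d R).card * (𝒯).card * χ⟦q⟧ * (q * (1 - q)) := by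
      linarith [hb]
    calc (χ'⟦q⟧) ^ 2 * (q * (1 - q)) = ((q * (1 - q)) ^ 2 * (χ'⟦q⟧) ^ 2) / (q * (1 - q)) := by
          field_simp
      _ ≤ ((box d R).card * (𝒯).card * χ⟦q⟧ * (q * (1 - q))) / (q * (1 - q)) :=
          div_le_div_of_nonneg_right this hqq.le
      _ = (box d R).card * (𝒯).card * χ⟦q⟧ := by rw [mul_div_assoc, div_self hqq.ne', mul_one]
  have hM : 0 ≤ (box d R).card * (𝒯).card / (q * (1 - q)) := by positivity
  -- take square roots
  have h2 : |χ'⟦q⟧| ≤ Real.sqrt ((box d R).card * (𝒯).card / (q * (1 - q))) * Real.sqrt χ⟦q⟧ := by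
    rw [← Real.sqrt_sq_eq_abs, ← Real.sqrt_mul hM]
    exact Real.sqrt_le_sqrt h1
  calc χ'⟦q⟧ / (2 * Real.sqrt χ⟦q⟧) ≤ |χ'⟦q⟧| / (2 * Real.sqrt χ⟦q⟧) :=
        div_le_div_of_nonneg_right (le_abs_self _) (by positivity)
    _ ≤ (Real.sqrt ((box d R).card * (𝒯).card / (q * (1 - q))) * Real.sqrt χ⟦q⟧) /
          (2 * Real.sqrt χ⟦q⟧) := div_le_div_of_nonneg_right h2 (by positivity)
    _ = (1 / 2) * Real.sqrt ((box d R).card * (𝒯).card / (q * (1 - q))) := by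
        field_simp

/-- **PERSIST√ (general `d`, polynomial form)**: for `0 < a ≤ x ≤ y ≤ b < 1`,
`√χ(y) - √χ(x) ≤ ½ √(|Λ||T|/(a(1-b))) · (y - x)`. -/
theorem sqrt_chi_sub_le {a b x y : ℝ} (ha : 0 < a) (hb : b < 1) (hax : a ≤ x) (hxy : x ≤ y)
    (hyb : y ≤ b) :
    Real.sqrt χ⟦y⟧ - Real.sqrt χ⟦x⟧ ≤
      (1 / 2) * Real.sqrt ((box d R).card * (𝒯).card / (a * (1 - b))) * (y - x) := by
  set M : ℝ := (1 / 2) * Real.sqrt ((box d R).card * (𝒯).card / (a * (1 - b))) with hM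
  have hderiv : ∀ q ∈ Set.Icc a b, HasDerivAt (fun q : ℝ => Real.sqrt χ⟦q⟧)
      (χ'⟦q⟧ / (2 * Real.sqrt χ⟦q⟧)) q := by
    intro q hq
    have hq0 : 0 < q := ha.trans_le hq.1
    have hq1 : q < 1 := hq.2.trans_lt hb
    have hχ : 1 ≤ χ⟦q⟧ := one_le_chi hq0.le hq1.le
    exact (hasDerivAt_chi q).sqrt (by linarith)
  have hcont : ContinuousOn (fun q : ℝ => Real.sqrt χ⟦q⟧) (Set.Icc a b) :=
    fun q hq => (hderiv q hq).continuousAt.continuousWithinAt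
  have hdiff : DifferentiableOn ℝ (fun q : ℝ => Real.sqrt χ⟦q⟧) (interior (Set.Icc a b)) := by
    rw [interior_Icc]
    exact fun q hq => (hderiv q (Set.Ioo_subset_Icc_self hq)).differentiableAt.differentiableWithinAt
  have hbound : ∀ q ∈ interior (Set.Icc a b), deriv (fun q : ℝ => Real.sqrt χ⟦q⟧) q ≤ M := by
    rw [interior_Icc]
    intro q hq
    have hq0 : 0 < q := ha.trans hq.1
    have hq1 : q < 1 := hq.2.trans hb
    rw [(hderiv q (Set.Ioo_subset_Icc_self hq)).deriv]
    refine (deriv_sqrt_chi_le hq0 hq1).trans ?_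
    rw [hM]
    refine mul_le_mul_of_nonneg_left (Real.sqrt_le_sqrt ?_) (by norm_num)
    have hab : 0 < a * (1 - b) := mul_pos ha (by linarith)
    have hqq : a * (1 - b) ≤ q * (1 - q) :=
      mul_le_mul hq.1.le (by linarith [hq.2]) (by linarith) hq0.le
    exact div_le_div_of_nonneg_left (by positivity) hab hqq
  exact (convex_Icc a b).image_sub_le_mul_sub_of_deriv_le hcont hdiff hbound x
    ⟨hax, hxy.trans hyb⟩ y ⟨hax.trans hxy, hyb⟩ hxy

/-- **PERSIST√ (general `d`, percolation form)**: for parameters `0 < a ≤ p ≤ p' ≤ b < 1`,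
`√χᶠ_R(p') - √χᶠ_R(p) ≤ ½ √(2d (2R+1)^{2d}/(a(1-b))) (p' - p)`: the square root of the free
susceptibility is Lipschitz in the parameter with constant `O(R^d)`. -/
theorem sqrt_freeSusc_sub_le {a b : ℝ} (ha : 0 < a) (hb : b < 1) (p p' : unitInterval)
    (hap : a ≤ (p : ℝ)) (hpp : p ≤ p') (hpb : (p' : ℝ) ≤ b) :
    Real.sqrt (∑ y ∈ box d R, (bondPercolation (zdGraph d) p').real 𝒜⟦y⟧) -
        Real.sqrt (∑ y ∈ box d R, (bondPercolation (zdGraph d) p).real 𝒜⟦y⟧) ≤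
      (1 / 2) * Real.sqrt (2 * d * ((2 * R + 1) ^ d : ℕ) ^ 2 / (a * (1 - b))) *
        ((p' : ℝ) - p) := by
  rw [← chi_eq_freeSusc, ← chi_eq_freeSusc]
  refine (sqrt_chi_sub_le ha hb hap (Subtype.coe_le_coe.2 hpp) hpb).trans ?_
  have hpp' : 0 ≤ (p' : ℝ) - p := sub_nonneg.2 (Subtype.coe_le_coe.2 hpp)
  refine mul_le_mul_of_nonneg_right ?_ hpp'
  refine mul_le_mul_of_nonneg_left (Real.sqrt_le_sqrt ?_) (by norm_num)
  have hab : 0 < a * (1 - b) := mul_pos ha (by linarith)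
  refine div_le_div_of_nonneg_right ?_ hab.le
  have hT := card_T_le (d := d) (R := R)
  have hΛ : ((box d R).card : ℝ) = ((2 * R + 1) ^ d : ℕ) := by rw [card_box]
  have hΛ0 : 0 ≤ ((box d R).card : ℝ) := by positivity
  calc ((box d R).card : ℝ) * (𝒯).card ≤ (box d R).card * (2 * d * (box d R).card) :=
        mul_le_mul_of_nonneg_left hT hΛ0
    _ = 2 * d * ((2 * R + 1) ^ d : ℕ) ^ 2 := by rw [hΛ]; ring

/-! ### §6 `d = 3`: the window `[p_c - R^{-7/4}/68, p_c]` -/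

/-- `p_c(ℤ³) ≥ 1/5` (non-backtracking path counting). -/
theorem fifth_le_pc : (1 : ℝ) / 5 ≤ (criticalProbI 3 : ℝ) := by
  have h := inv_le_criticalProbI (d := 3) (by norm_num)
  norm_num at h
  exact h

/-- The window point `p_R = p_c - R^{-7/4}/68` lies in `[1/6, p_c]` for `R ≥ 1`. -/
theorem window_bounds {R : ℕ} (hR : 1 ≤ R) :
    0 < (R : ℝ) ^ (-(7 : ℝ) / 4) / 68 ∧ (R : ℝ) ^ (-(7 : ℝ) / 4) / 68 ≤ 1 / 68 ∧
      (1 : ℝ) / 6 ≤ (criticalProbI 3 : ℝ) - (R : ℝ) ^ (-(7 : ℝ) / 4) / 68 := by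
  have hR1 : (1 : ℝ) ≤ R := by exact_mod_cast hR
  have hRpos : (0 : ℝ) < R := by linarith
  have h1 : (R : ℝ) ^ (-(7 : ℝ) / 4) ≤ 1 :=
    Real.rpow_le_one_of_one_le_of_nonpos hR1 (by norm_num)
  have h2 : 0 < (R : ℝ) ^ (-(7 : ℝ) / 4) := Real.rpow_pos_of_pos hRpos _
  refine ⟨by positivity, by linarith, ?_⟩
  have := fifth_le_pc
  linarith

/-- **PERSIST√ at `p_c(ℤ³)`**: for `1/6 ≤ p ≤ p_c` and every `R`,
`√χᶠ_R(p_c) ≤ √χᶠ_R(p) + ½ √(36 (2R+1)⁶ / (1 - p_c)) · (p_c - p)` — an explicit `O(R³)` Lipschitz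
constant, so the free susceptibility at `p_c` is controlled by its value at any `p` within
`O(R^{-7/4})` below `p_c`, up to `O(R^{5/2})`. -/
theorem sqrt_freeSusc_crit_le (R : ℕ) (p : unitInterval) (hp : (1 : ℝ) / 6 ≤ (p : ℝ))
    (hpc : p ≤ criticalProbI 3) :
    Real.sqrt (∑ y ∈ box 3 R, (bondPercolation (zdGraph 3) (criticalProbI 3)).real
        (openConnIn (↑(box 3 R) : Set (Site 3)) 0 y)) ≤
      Real.sqrt (∑ y ∈ box 3 R, (bondPercolation (zdGraph 3) p).real
        (openConnIn (↑(box 3 R) : Set (Site 3)) 0 y)) +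
      (1 / 2) * Real.sqrt (2 * (3 : ℕ) * ((2 * R + 1) ^ 3 : ℕ) ^ 2 /
          ((1 / 6) * (1 - (criticalProbI 3 : ℝ)))) * ((criticalProbI 3 : ℝ) - p) := by
  have hpc1 : ((criticalProbI 3 : unitInterval) : ℝ) < 1 := by
    rw [coe_criticalProbI]; exact criticalProb_zd_lt_one (d := 3) (by norm_num)
  have h := sqrt_freeSusc_sub_le (d := 3) (R := R) (a := 1 / 6) (b := (criticalProbI 3 : ℝ))
    (by norm_num) hpc1 p (criticalProbI 3) hp hpc le_rfl
  linarith

end Persist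

open Persist in
/-- **The crux is equivalent to its scale-dependent subcritical form** (census S⁺2 / D4):
`S(1/2)` at `p_c` holds iff the same `R^{5/2}` bound holds for the free susceptibility taken at the
SUBCRITICAL parameter `p_R = p_c - R^{-7/4}/68` (clamped into `[0,1]`; for `R ≥ 1` it lies in
`[1/6, p_c]`).  `→` is monotonicity in `p`; `←` is PERSIST√:
`χᶠ_R(p_c) ≤ 2 χᶠ_R(p_R) + A² R^{6} R^{-7/2} = 2 χᶠ_R(p_R) + A² R^{5/2}`. -/
theorem freeSusceptibilityPowerSaving_iff_persist :
    Summit.CriticalPhenomena.PercolationContinuityZ3.Theses.PercShatteringRace.FreeSusceptibilityPowerSaving ↔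
      ∃ C : ℝ, ∀ R : ℕ, 1 ≤ R →
        ∑ y ∈ box 3 R,
          (bondPercolation (zdGraph 3)
            (Set.projIcc (0 : ℝ) 1 zero_le_one
              ((criticalProbI 3 : ℝ) - (R : ℝ) ^ (-(7 : ℝ) / 4) / 68))).real
            (openConnIn (↑(box 3 R) : Set (Site 3)) 0 y)
          ≤ C * (R : ℝ) ^ ((5 : ℝ) / 2) := by
  have hpc1 : ((criticalProbI 3 : unitInterval) : ℝ) < 1 := by
    rw [coe_criticalProbI]; exact criticalProb_zd_lt_one (d := 3) (by norm_num)
  have hpc0 : (0 : ℝ) < 1 - (criticalProbI 3 : ℝ) := by linarith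
  constructor
  · rintro ⟨C, hC⟩
    refine ⟨C, fun R hR => ?_⟩
    obtain ⟨hδ0, hδ1, hq6⟩ := window_bounds hR
    set qR : ℝ := (criticalProbI 3 : ℝ) - (R : ℝ) ^ (-(7 : ℝ) / 4) / 68 with hqR
    have hq0 : 0 ≤ qR := by linarith
    have hqpc : qR ≤ (criticalProbI 3 : ℝ) := by linarith
    have hq1 : qR ≤ 1 := by linarith
    rw [Set.projIcc_of_mem _ ⟨hq0, hq1⟩]
    have hle : (⟨qR, ⟨hq0, hq1⟩⟩ : unitInterval) ≤ criticalProbI 3 := Subtype.coe_le_coe.1 hqpc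
    refine le_trans (Finset.sum_le_sum fun y _ => ?_) (hC R hR)
    exact real_mono_of_isUpperSet (zdGraph 3) (isUpperSet_openConnIn _ _ _)
      (measurableSet_openConnIn _ 0 y) hle
  · rintro ⟨C, hC⟩
    -- the Lipschitz constant of `√χᶠ_R` on `[1/6, p_c]` is at most `c₁ R³`
    set c₁ : ℝ := (1 / 2) * Real.sqrt (6 * 729 / ((1 / 6) * (1 - (criticalProbI 3 : ℝ)))) with hc₁
    set c₂ : ℝ := c₁ / 68 with hc₂
    refine ⟨2 * C + 2 * c₂ ^ 2, fun R hR => ?_⟩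
    obtain ⟨hδ0, hδ1, hq6⟩ := window_bounds hR
    have hR1 : (1 : ℝ) ≤ R := by exact_mod_cast hR
    have hR0 : (0 : ℝ) < R := by linarith
    set δ : ℝ := (R : ℝ) ^ (-(7 : ℝ) / 4) / 68 with hδ
    set qR : ℝ := (criticalProbI 3 : ℝ) - δ with hqR
    have hq0 : 0 ≤ qR := by linarith
    have hqpc : qR ≤ (criticalProbI 3 : ℝ) := by linarith
    have hq1 : qR ≤ 1 := by linarith
    have hCR := hC R hR
    rw [Set.projIcc_of_mem _ ⟨hq0, hq1⟩] at hCR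
    set p : unitInterval := ⟨qR, ⟨hq0, hq1⟩⟩ with hp
    have hple : p ≤ criticalProbI 3 := Subtype.coe_le_coe.1 hqpc
    -- abbreviations for the two susceptibilities
    set X : ℝ := ∑ y ∈ box 3 R, (bondPercolation (zdGraph 3) (criticalProbI 3)).real
        (openConnIn (↑(box 3 R) : Set (Site 3)) 0 y) with hX
    set Y : ℝ := ∑ y ∈ box 3 R, (bondPercolation (zdGraph 3) p).real
        (openConnIn (↑(box 3 R) : Set (Site 3)) 0 y) with hY
    have hX0 : 0 ≤ X := Finset.sum_nonneg fun _ _ => measureReal_nonneg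
    have hY0 : 0 ≤ Y := Finset.sum_nonneg fun _ _ => measureReal_nonneg
    -- PERSIST√
    have hpers := sqrt_freeSusc_crit_le R p hq6 hple
    have hdiff : (criticalProbI 3 : ℝ) - (p : ℝ) = δ := by rw [hp]; simp [hqR]
    rw [hdiff] at hpers
    -- bound the Lipschitz constant by `c₁ R³`
    have hcube : ((2 * R + 1) ^ 3 : ℕ) ≤ (27 * R ^ 3 : ℕ) := by
      have : 2 * R + 1 ≤ 3 * R := by omega
      calc (2 * R + 1) ^ 3 ≤ (3 * R) ^ 3 := Nat.pow_le_pow_left this 3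
        _ = 27 * R ^ 3 := by ring
    have hcube' : (((2 * R + 1) ^ 3 : ℕ) : ℝ) ≤ 27 * (R : ℝ) ^ 3 := by exact_mod_cast hcube
    have hsqrt : Real.sqrt (2 * (3 : ℕ) * ((2 * R + 1) ^ 3 : ℕ) ^ 2 /
        ((1 / 6) * (1 - (criticalProbI 3 : ℝ)))) ≤
        Real.sqrt (6 * 729 / ((1 / 6) * (1 - (criticalProbI 3 : ℝ)))) * (R : ℝ) ^ 3 := by
      have hx : (0 : ℝ) ≤ 6 * 729 / ((1 / 6) * (1 - (criticalProbI 3 : ℝ))) := by positivity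
      have hden : (0 : ℝ) < (1 / 6) * (1 - (criticalProbI 3 : ℝ)) := by positivity
      have hnum : (2 : ℝ) * (3 : ℕ) * (((2 * R + 1) ^ 3 : ℕ) : ℝ) ^ 2 ≤ 6 * 729 * ((R : ℝ) ^ 3) ^ 2 := by
        calc (2 : ℝ) * (3 : ℕ) * (((2 * R + 1) ^ 3 : ℕ) : ℝ) ^ 2
            ≤ 2 * (3 : ℕ) * (27 * (R : ℝ) ^ 3) ^ 2 := by gcongr
          _ = 6 * 729 * ((R : ℝ) ^ 3) ^ 2 := by push_cast; ring
      rw [← Real.sqrt_sq (by positivity : (0 : ℝ) ≤ (R : ℝ) ^ 3), ← Real.sqrt_mul hx]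
      refine Real.sqrt_le_sqrt ?_
      calc (2 : ℝ) * (3 : ℕ) * (((2 * R + 1) ^ 3 : ℕ) : ℝ) ^ 2 / ((1 / 6) * (1 - (criticalProbI 3 : ℝ)))
          ≤ 6 * 729 * ((R : ℝ) ^ 3) ^ 2 / ((1 / 6) * (1 - (criticalProbI 3 : ℝ))) :=
            div_le_div_of_nonneg_right hnum hden.le
        _ = 6 * 729 / ((1 / 6) * (1 - (criticalProbI 3 : ℝ))) * ((R : ℝ) ^ 3) ^ 2 := by ring
    have hLip : (1 / 2) * Real.sqrt (2 * (3 : ℕ) * ((2 * R + 1) ^ 3 : ℕ) ^ 2 /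
        ((1 / 6) * (1 - (criticalProbI 3 : ℝ)))) ≤ c₁ * (R : ℝ) ^ 3 := by
      calc (1 / 2) * Real.sqrt (2 * (3 : ℕ) * ((2 * R + 1) ^ 3 : ℕ) ^ 2 /
            ((1 / 6) * (1 - (criticalProbI 3 : ℝ))))
          ≤ (1 / 2) * (Real.sqrt (6 * 729 / ((1 / 6) * (1 - (criticalProbI 3 : ℝ)))) * (R : ℝ) ^ 3) :=
            by linarith [hsqrt]
        _ = c₁ * (R : ℝ) ^ 3 := by rw [hc₁]; ring
    have hδR : c₁ * (R : ℝ) ^ 3 * δ = c₂ * (R : ℝ) ^ ((5 : ℝ) / 4) := by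
      rw [hc₂, hδ]
      have : (R : ℝ) ^ 3 * (R : ℝ) ^ (-(7 : ℝ) / 4) = (R : ℝ) ^ ((5 : ℝ) / 4) := by
        rw [← Real.rpow_natCast, ← Real.rpow_add hR0]; norm_num
      rw [← this]; ring
    have hstep : Real.sqrt X ≤ Real.sqrt Y + c₂ * (R : ℝ) ^ ((5 : ℝ) / 4) := by
      have : (1 / 2) * Real.sqrt (2 * (3 : ℕ) * ((2 * R + 1) ^ 3 : ℕ) ^ 2 /
          ((1 / 6) * (1 - (criticalProbI 3 : ℝ)))) * δ ≤ c₁ * (R : ℝ) ^ 3 * δ :=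
        mul_le_mul_of_nonneg_right hLip hδ0.le
      linarith
    -- square it
    have hc₂0 : 0 ≤ c₂ * (R : ℝ) ^ ((5 : ℝ) / 4) := by positivity
    have hsq : X ≤ 2 * Y + 2 * (c₂ * (R : ℝ) ^ ((5 : ℝ) / 4)) ^ 2 := by
      have h1 : Real.sqrt X ^ 2 ≤ (Real.sqrt Y + c₂ * (R : ℝ) ^ ((5 : ℝ) / 4)) ^ 2 :=
        pow_le_pow_left₀ (Real.sqrt_nonneg X) hstep 2
      rw [Real.sq_sqrt hX0] at h1
      have h2 : (Real.sqrt Y + c₂ * (R : ℝ) ^ ((5 : ℝ) / 4)) ^ 2 ≤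
          2 * Real.sqrt Y ^ 2 + 2 * (c₂ * (R : ℝ) ^ ((5 : ℝ) / 4)) ^ 2 := by
        nlinarith [sq_nonneg (Real.sqrt Y - c₂ * (R : ℝ) ^ ((5 : ℝ) / 4))]
      rw [Real.sq_sqrt hY0] at h2
      linarith
    have hpow : ((R : ℝ) ^ ((5 : ℝ) / 4)) ^ 2 = (R : ℝ) ^ ((5 : ℝ) / 2) := by
      rw [← Real.rpow_natCast, ← Real.rpow_mul hR0.le]; norm_num
    calc X ≤ 2 * Y + 2 * (c₂ * (R : ℝ) ^ ((5 : ℝ) / 4)) ^ 2 := hsq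
      _ = 2 * Y + 2 * c₂ ^ 2 * (R : ℝ) ^ ((5 : ℝ) / 2) := by rw [mul_pow, hpow]; ring
      _ ≤ 2 * (C * (R : ℝ) ^ ((5 : ℝ) / 2)) + 2 * c₂ ^ 2 * (R : ℝ) ^ ((5 : ℝ) / 2) := by
          linarith [hCR]
      _ = (2 * C + 2 * c₂ ^ 2) * (R : ℝ) ^ ((5 : ℝ) / 2) := by ring

/-- Registered anchor `stub_persistIff` of crux stmt-CriticalPhenomena-5786 (PERSIST part 2 = census
`PersistForm`): the crux at `p_c` is equivalent to the same bound at `p_c - R^{-7/4}/68`. -/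
theorem stub_persistIff :
   
    Summit.CriticalPhenomena.PercolationContinuityZ3.Theses.PercShatteringRace.FreeSusceptibilityPowerSaving
    ↔ ∃ C : ℝ, ∀ R : ℕ, 1 ≤ R → ∑ y ∈ box 3 R, (bondPercolation (zdGraph 3) (Set.projIcc (0 : ℝ) 1
    zero_le_one ((criticalProbI 3 : ℝ) - (R : ℝ) ^ (-(7 : ℝ) / 4) / 68))).real (openConnIn (↑(box
    3 R) : Set (Site 3)) 0 y) ≤ C * (R : ℝ) ^ ((5 : ℝ) / 2) :=
  freeSusceptibilityPowerSaving_iff_persist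

end

end Summit.CriticalPhenomena.PercolationContinuityZ3.Theorems
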